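import Summits.AnomalousDissipation.AnomalousDissipation.Theorems.MarginalStabilityChainStrainedLayerLawClockReduction
import HarnessLib

/-!
# Crux `MarginalStabilityChain.StrainedLayerLaw` (stmt-AnomalousDissipation-3007), line `FirstLemmasR2K4`
# (log-enstrophy clock + Nash roundness): the total-enstrophy law and the finite-window dissipation ceiling

Support file (`--supports stmt-AnomalousDissipation-3007`; registered sub-goal `enstrophy_window_ceiling` of line
`FirstLemmasR2K4`, lead c7, wave 1).

What it proves: for every classical solution `(u, v, p)` of the stretched two-dimensional Navier–Stokes layer class
`IsStretchedLayerNSSolutionOn (Ioi 0) ν 1 1 L u v p` (`ν, L > 0`) with uniform exponential shear tails on every compact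
time interval `[a, b] ⊂ (0, ∞)` and all `0 < s ≤ t`, with `Ω(τ) = ∫_{(0,L]}∫_ℝ ω(τ)²` the TOTAL enstrophy of one
period strip (`ω = ∂ₓv − ∂_yu`):

* `Ω(t) ≤ e^{t−s} Ω(s)` — the total-enstrophy law `Ω′ = Ω − 2νP ≤ Ω` of the class (stretching rate `1`; the transport
  by `(u, v − y)`, `div = −1`, contributes `+Ω` to `d/dt ∫∫ω²` and the stretching `+2Ω`, net `ωF′(ω) − F(ω) = ω²` for
  `F(r) = r²`), integrated;
* `∫⁻_{τ ∈ (s,t]} layerDissipation ν L (u τ) (v τ) ≤ ofReal ((ν/L)(e^{t−s} − 1) Ω(s))` — every finite window carries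
  at most `(ν/L)Ω(s)(e^{t−s} − 1)` of dissipation, because the dissipation of a tailed slice is
  `D = (ν/L)∫∫|∇(u,v)|² = (ν/L)Ω` (`layerDissipation_eq_ofReal`, `kato_integral_gradSq_eq_enstrophy`).

Since the laminar member has `νΩ ≈ L(ν/4π)^{1/2} → 0`, a `ν`-uniform `O(1)` floor of the long-time mean dissipation
(the crux) can only come from windows of length `≳ ½ log(1/ν)`: the content of the crux is in the eternal regime.

Route (the `F(r) = r²` case of the Kato / enstrophy chain of the sum-rule line, tools F, G, L, N of
`…StubVorticityUniformBounds*`): the cut-off enstrophy `N_R(τ) = ∫∫ ω(τ)²ψ_R²` (`ψ_R(y) = σ(2 − y/R)σ(2 + y/R)`,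
`σ = Real.smoothTransition`) is differentiable in time (`kato_hasDerivAt_enstrophy`) with
`N_R′ ≤ N_R − ν‖∇(ωψ_R)‖² + c₀/R ≤ N_R + c₀/R` (`stub_vorticityUniformBounds_enstrophySlice`, the tails bound the
cutoff-transition terms); Grönwall on `[s, t]` (Mathlib `le_gronwallBound_of_liminf_deriv_right_le`) gives
`N_R(t) ≤ e^{t−s}N_R(s) + (c₀/R)(e^{t−s} − 1)`, and `R → ∞` by dominated convergence (`ω² ≤ C²e^{−k|y|}`). The window
bound integrates the pointwise law `D(τ) = (ν/L)Ω(τ) ≤ (ν/L)e^{τ−s}Ω(s)` over `(s, t]` in `ℝ≥0∞`. All `[folklore]`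
(enstrophy balance of 2-D Navier–Stokes: Majda–Bertozzi 2002, §1.4 and §3.1.1, for the stretched class).
-/

-- `Summit.<Summit>.<Problem>` is the tree's mandated summit-side namespace (CONVENTIONS §2); for this
-- single-conjunct summit the two coincide, so the duplicate is deliberate.
set_option linter.dupNamespace false

noncomputable section

open scoped Topology ENNReal
open Filter Set Function MeasureTheory

namespace Summit.AnomalousDissipation.AnomalousDissipation.Theorems.StrainedLayerLaw.LogEnstrophyClock

open Literature.Analysis.FluidPDE Literature.Analysis.FluidPDE.StretchedLayer
open Summit.AnomalousDissipation.AnomalousDissipation.Theses.MarginalStabilityChain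
open Summit.AnomalousDissipation.AnomalousDissipation.Theorems.StrainedLayerLaw.StrainWorkSumRule

/-! ## Slice facts: integrability of `ω²` and removal of the cutoff -/

section SliceFacts

variable {L C k : ℝ} {f g : ℝ → ℝ → ℝ}

/-- `ω²` is integrable on the period strip under shear tails (`ω² ≤ C²e^{−k|y|}`). [folklore] -/
theorem enstrophyCeiling_integrableOn_sq (hk : 0 < k) (hT : SliceTails C k f g)
    (hf : ContDiff ℝ 2 (fun q : ℝ × ℝ => f q.1 q.2)) (hg : ContDiff ℝ 2 (fun q : ℝ × ℝ => g q.1 q.2)) :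
    IntegrableOn (fun q : ℝ × ℝ => vorticity f g q.1 q.2 ^ 2) (Ioc 0 L ×ˢ univ) := by
  have cω : Continuous fun q : ℝ × ℝ => vorticity f g q.1 q.2 := (contDiff_one_vorticity hf hg).continuous
  refine integrableOn_strip_of_abs_le_exp (cω.pow 2) (sq_nonneg C) hk fun x _ y => ?_
  rw [abs_of_nonneg (sq_nonneg _)]
  exact clock_vorticity_sq_le hk hT x y

/-- **Removal of the cutoff**: `∫∫ ω²ψ_R² → ∫∫ ω²` as `R → ∞` (dominated convergence, `0 ≤ ψ_R ≤ 1`, `ψ_R → 1`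
pointwise, `ω²` integrable under shear tails). [folklore] -/
theorem enstrophyCeiling_cutoff_limit (hk : 0 < k) (hT : SliceTails C k f g)
    (hf : ContDiff ℝ 2 (fun q : ℝ × ℝ => f q.1 q.2)) (hg : ContDiff ℝ 2 (fun q : ℝ × ℝ => g q.1 q.2)) :
    Tendsto (fun R : ℝ => ∫ q in Ioc 0 L ×ˢ univ, vorticity f g q.1 q.2 ^ 2 *
      (Real.smoothTransition (2 - q.2 / R) * Real.smoothTransition (2 + q.2 / R)) ^ 2) atTop
      (𝓝 (∫ q in Ioc 0 L ×ˢ univ, vorticity f g q.1 q.2 ^ 2)) := by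
  have cω : Continuous fun q : ℝ × ℝ => vorticity f g q.1 q.2 := (contDiff_one_vorticity hf hg).continuous
  refine tendsto_integral_filter_of_dominated_convergence (fun q => vorticity f g q.1 q.2 ^ 2) ?_ ?_
    (enstrophyCeiling_integrableOn_sq hk hT hf hg) ?_
  · exact Eventually.of_forall fun R =>
      ((cω.pow 2).mul (((kato_cutoff_contDiff R).continuous.comp continuous_snd).pow 2)).aestronglyMeasurable
  · refine Eventually.of_forall fun R => Eventually.of_forall fun q => ?_
    rw [Real.norm_eq_abs, abs_mul, abs_of_nonneg (sq_nonneg _), abs_of_nonneg (sq_nonneg _)]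
    have hc1 := kato_cutoff_le_one R q.2
    have hc0 := kato_cutoff_nonneg R q.2
    have hsq : (Real.smoothTransition (2 - q.2 / R) * Real.smoothTransition (2 + q.2 / R)) ^ 2 ≤ 1 := by
      nlinarith
    exact mul_le_of_le_one_right (sq_nonneg _) hsq
  · refine Eventually.of_forall fun q => tendsto_const_nhds.congr' ?_
    filter_upwards [eventually_ge_atTop |q.2|, eventually_gt_atTop (0:ℝ)] with R h1 h2
    rw [kato_cutoff_eq_one h2 h1]; ring

end SliceFacts

/-! ## The cut-off enstrophy law at one level and the strip form of the enstrophy law -/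

section StripLaw

variable {ν L : ℝ} {u v p : ℝ → ℝ → ℝ → ℝ}

/-- **One cutoff level.** Along a solution with shear tails `SliceTails C k` on `[s/2, t + 1]` (`0 < s < t`) and for the
cutoff `ψ_R`, `R ≥ 1`: the cut-off enstrophy `N_R(τ) = ∫∫ ω(τ)²ψ_R²` obeys
`N_R(t) ≤ e^{t−s}N_R(s) + (c₀/R)(e^{t−s} − 1)`, `c₀ = 2C_σC²(2∫∫(C+|y|)e^{−k|y|} + 4νC_σ∫∫e^{−k|y|} + 4ν∫∫e^{−k|y|})`
(`N_R′ ≤ N_R − ν‖∇(ωψ_R)‖² + c₀/R` by `kato_hasDerivAt_enstrophy` and `stub_vorticityUniformBounds_enstrophySlice`, then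
Grönwall, Mathlib `le_gronwallBound_of_liminf_deriv_right_le`). [folklore] -/
theorem enstrophyCeiling_cutoff_level (hsol : IsStretchedLayerNSSolutionOn (Ioi 0) ν 1 1 L u v p) (hν : 0 < ν)
    (hL : 0 < L) {s t : ℝ} (hs : 0 < s) (hst : s < t) {C k : ℝ} (hk : 0 < k)
    (hST : ∀ τ ∈ Icc (s / 2) (t + 1), SliceTails C k (u τ) (v τ)) {Cσ : ℝ} (hCσ0 : 0 ≤ Cσ)
    (hCσ : ∀ x, |deriv Real.smoothTransition x| ≤ Cσ) {R : ℝ} (hR1 : 1 ≤ R) :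
    ∫ q in Ioc 0 L ×ˢ univ, vorticity (u t) (v t) q.1 q.2 ^ 2 *
        (Real.smoothTransition (2 - q.2 / R) * Real.smoothTransition (2 + q.2 / R)) ^ 2 ≤
      (∫ q in Ioc 0 L ×ˢ univ, vorticity (u s) (v s) q.1 q.2 ^ 2 *
        (Real.smoothTransition (2 - q.2 / R) * Real.smoothTransition (2 + q.2 / R)) ^ 2) * Real.exp (t - s) +
      2 * Cσ * C ^ 2 * (2 * (∫ q in Ioc 0 L ×ˢ univ, (C + |q.2|) * Real.exp (-k * |q.2|)) +
          4 * ν * Cσ * (∫ q in Ioc 0 L ×ˢ univ, Real.exp (-k * |q.2|)) +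
          4 * ν * ∫ q in Ioc 0 L ×ˢ univ, Real.exp (-k * |q.2|)) / R * (Real.exp (t - s) - 1) := by
  have hR : 0 < R := one_pos.trans_le hR1
  set ψ : ℝ → ℝ := fun y => Real.smoothTransition (2 - y / R) * Real.smoothTransition (2 + y / R) with hψdef
  -- properties of the cutoff
  have hψ : ContDiff ℝ 1 ψ := kato_cutoff_contDiff R
  have hψ0 : ∀ y, 0 ≤ ψ y := fun y => kato_cutoff_nonneg R y
  have hψ1 : ∀ y, ψ y ≤ 1 := fun y => kato_cutoff_le_one R y
  have hψ1' : ∀ y, |ψ y| ≤ 1 := fun y => kato_cutoff_abs_le_one R y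
  have hψR : ∀ y, 2 * R ≤ |y| → ψ y = 0 := fun y hy => kato_cutoff_eq_zero hR hy
  have hψ'b : ∀ y, |deriv ψ y| ≤ 2 * Cσ / R := fun y => kato_cutoff_deriv_bound hR hCσ y
  have hψ'0 : ∀ y, 2 * R < |y| → deriv ψ y = 0 := fun y hy => kato_cutoff_deriv_eq_zero_of_gt hR hy
  have hDle : 2 * Cσ / R ≤ 2 * Cσ := div_le_self (by positivity) hR1
  have hC : 0 ≤ C := (hST s ⟨by linarith, by linarith⟩).nonneg
  have hθ : ContDiff ℝ 1 (fun y => ψ y ^ 2) := hψ.pow 2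
  have hθ1 : ∀ y, |ψ y ^ 2| ≤ 1 := fun y => by
    rw [abs_of_nonneg (sq_nonneg _)]; nlinarith [hψ0 y, hψ1 y]
  have hθR : ∀ y, 2 * R ≤ |y| → ψ y ^ 2 = 0 := fun y hy => by rw [hψR y hy]; ring
  -- notation for the constants
  have hS : MeasurableSet (Ioc (0:ℝ) L ×ˢ (univ : Set ℝ)) := measurableSet_Ioc.prod MeasurableSet.univ
  set IW : ℝ := ∫ q in Ioc 0 L ×ˢ univ, (C + |q.2|) * Real.exp (-k * |q.2|) with hIW
  set Ik : ℝ := ∫ q in Ioc 0 L ×ˢ univ, Real.exp (-k * |q.2|) with hIk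
  have hIk0 : 0 ≤ Ik := setIntegral_nonneg hS fun q _ => (Real.exp_pos _).le
  set c₀ : ℝ := 2 * Cσ * C ^ 2 * (2 * IW + 4 * ν * Cσ * Ik + 4 * ν * Ik) with hc₀
  -- the cutoff-transition error at level `R` is at most `c₀ / R`
  have herr : 2 * Cσ / R * C ^ 2 * (2 * IW + 2 * ν * (2 * Cσ / R) * Ik + 4 * ν * Ik) ≤ c₀ / R := by
    have h1 : 2 * IW + 2 * ν * (2 * Cσ / R) * Ik + 4 * ν * Ik ≤ 2 * IW + 4 * ν * Cσ * Ik + 4 * ν * Ik := by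
      nlinarith [mul_le_mul_of_nonneg_left hDle (by positivity : 0 ≤ 2 * ν * Ik)]
    simp only [hc₀]
    rw [show 2 * Cσ / R * C ^ 2 * (2 * IW + 2 * ν * (2 * Cσ / R) * Ik + 4 * ν * Ik) =
      (2 * Cσ * C ^ 2 * (2 * IW + 2 * ν * (2 * Cσ / R) * Ik + 4 * ν * Ik)) / R by ring]
    exact div_le_div_of_nonneg_right (mul_le_mul_of_nonneg_left h1 (by positivity)) hR.le
  -- the cut-off enstrophy, its time derivative, and the differential inequality `N′ ≤ N + c₀/R`
  set N : ℝ → ℝ := fun τ => ∫ q in Ioc 0 L ×ˢ univ, vorticity (u τ) (v τ) q.1 q.2 ^ 2 * ψ q.2 ^ 2 with hN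
  set N' : ℝ → ℝ := fun τ => 2 * ∫ q in Ioc 0 L ×ˢ univ, vorticity (u τ) (v τ) q.1 q.2 * ψ q.2 ^ 2 *
    (dX (fun x y => deriv (fun r => v r x y) τ) q.1 q.2 - dY (fun x y => deriv (fun r => u r x y) τ) q.1 q.2)
    with hN'
  have hderivN : ∀ τ ∈ Ioo (s / 2) (t + 1), HasDerivAt N (N' τ) τ := fun τ hτ =>
    kato_hasDerivAt_enstrophy hsol.contDiffOn_u hsol.contDiffOn_v hθ hθ1 hθR L (by positivity : (0:ℝ) < s / 2) hτ
  have hcontN : ContinuousOn N (Icc s t) := fun τ hτ =>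
    (hderivN τ ⟨by linarith [hτ.1], by linarith [hτ.2]⟩).continuousAt.continuousWithinAt
  have hbound : ∀ τ ∈ Ico s t, N' τ ≤ 1 * N τ + c₀ / R := by
    intro τ hτ
    have hτ0 : 0 < τ := hs.trans_le hτ.1
    have hTτ := hST τ ⟨by linarith [hτ.1], by linarith [hτ.2]⟩
    have hslice := stub_vorticityUniformBounds_enstrophySlice hsol hν.le hL hτ0 hk hTτ hψ hψ1' (R := R)
      (D := 2 * Cσ / R) hψR hψ'b hψ'0
    have eN : N τ = ∫ q in Ioc 0 L ×ˢ univ, (vorticity (u τ) (v τ) q.1 q.2 * ψ q.2) ^ 2 := by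
      simp only [hN]; exact integral_congr_ae (Eventually.of_forall fun q => by simp only; ring)
    have hPf0 : 0 ≤ ν * ∫ q in Ioc 0 L ×ˢ univ, (dX (fun x y => vorticity (u τ) (v τ) x y * ψ y) q.1 q.2 ^ 2 +
        dY (fun x y => vorticity (u τ) (v τ) x y * ψ y) q.1 q.2 ^ 2) :=
      mul_nonneg hν.le (setIntegral_nonneg hS fun q _ => by positivity)
    rw [eN, one_mul]
    simp only [hN']
    linarith [hslice, herr, hPf0]
  -- Grönwall on `[s, t]`
  have hG := le_gronwallBound_of_liminf_deriv_right_le (f := N) (f' := N') (δ := N s) (K := 1) (ε := c₀ / R)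
    (a := s) (b := t) hcontN
    (fun τ hτ _ hr => ((hderivN τ ⟨by linarith [hτ.1], by linarith [hτ.2]⟩).hasDerivWithinAt).liminf_right_slope_le hr)
    le_rfl hbound t (right_mem_Icc.2 hst.le)
  rw [gronwallBound_of_K_ne_0 one_ne_zero] at hG
  simp only [one_mul, div_one] at hG
  exact hG

/-- **The total-enstrophy law in strip form**: `∫∫ ω(t)² ≤ e^{t−s} ∫∫ ω(s)²` for `0 < s ≤ t` along a tailed classical
solution (`enstrophyCeiling_cutoff_level` for every `R ≥ 1`, then `R → ∞` by `enstrophyCeiling_cutoff_limit`).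
[folklore] -/
theorem enstrophyCeiling_strip_law (hsol : IsStretchedLayerNSSolutionOn (Ioi 0) ν 1 1 L u v p) (hν : 0 < ν)
    (hL : 0 < L) (htails : ∀ a b : ℝ, 0 < a → a < b → ExpTails (Icc a b) u v) {s t : ℝ} (hs : 0 < s)
    (hst : s ≤ t) :
    ∫ q in Ioc 0 L ×ˢ univ, vorticity (u t) (v t) q.1 q.2 ^ 2 ≤
      Real.exp (t - s) * ∫ q in Ioc 0 L ×ˢ univ, vorticity (u s) (v s) q.1 q.2 ^ 2 := by
  rcases hst.eq_or_lt with rfl | hst'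
  · rw [sub_self, Real.exp_zero, one_mul]
  obtain ⟨C, k, hk, hCk⟩ := htails (s / 2) (t + 1) (by positivity) (by linarith)
  have hST : ∀ τ ∈ Icc (s / 2) (t + 1), SliceTails C k (u τ) (v τ) := fun τ hτ => (hCk τ hτ).1
  obtain ⟨Cσ, hCσ0, hCσ⟩ := kato_smoothTransition_deriv_bound
  have ht0 : 0 < t := hs.trans hst'
  have hlim_t := enstrophyCeiling_cutoff_limit (L := L) hk (hST t ⟨by linarith, by linarith⟩)
    (hsol.contDiff_u (mem_Ioi.2 ht0)) (hsol.contDiff_v (mem_Ioi.2 ht0))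
  have hlim_s := enstrophyCeiling_cutoff_limit (L := L) hk (hST s ⟨by linarith, by linarith⟩)
    (hsol.contDiff_u (mem_Ioi.2 hs)) (hsol.contDiff_v (mem_Ioi.2 hs))
  set c₀ : ℝ := 2 * Cσ * C ^ 2 * (2 * (∫ q in Ioc 0 L ×ˢ univ, (C + |q.2|) * Real.exp (-k * |q.2|)) +
    4 * ν * Cσ * (∫ q in Ioc 0 L ×ˢ univ, Real.exp (-k * |q.2|)) +
    4 * ν * ∫ q in Ioc 0 L ×ˢ univ, Real.exp (-k * |q.2|)) with hc₀
  have hlim_rhs : Tendsto (fun R : ℝ => (∫ q in Ioc 0 L ×ˢ univ, vorticity (u s) (v s) q.1 q.2 ^ 2 *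
      (Real.smoothTransition (2 - q.2 / R) * Real.smoothTransition (2 + q.2 / R)) ^ 2) * Real.exp (t - s) +
      c₀ / R * (Real.exp (t - s) - 1)) atTop
      (𝓝 (Real.exp (t - s) * ∫ q in Ioc 0 L ×ˢ univ, vorticity (u s) (v s) q.1 q.2 ^ 2)) := by
    have h := (hlim_s.mul_const (Real.exp (t - s))).add
      (((tendsto_const_nhds (x := c₀)).div_atTop tendsto_id).mul_const (Real.exp (t - s) - 1))
    rw [zero_mul, add_zero, mul_comm] at h
    exact h
  refine le_of_tendsto_of_tendsto hlim_t hlim_rhs ?_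
  filter_upwards [eventually_ge_atTop (1:ℝ)] with R hR
  exact enstrophyCeiling_cutoff_level hsol hν hL hs hst' hk hST hCσ0 hCσ hR

end StripLaw

/-! ## The registered sub-goal -/

section Main

/-- **Total-enstrophy law and finite-window dissipation ceiling (registered sub-goal `enstrophy_window_ceiling` of
line `FirstLemmasR2K4`).** For every classical solution of the stretched two-dimensional Navier–Stokes layer class on
`(0, ∞)` (`ν, L > 0`) with uniform exponential shear tails on compact time intervals and all `0 < s ≤ t`:
`Ω(t) ≤ e^{t−s}Ω(s)` for the total enstrophy `Ω = ∫_{(0,L]}∫_ℝ ω²` of a period strip (the enstrophy law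
`Ω′ = Ω − 2νP ≤ Ω`, `enstrophyCeiling_strip_law`, with Fubini), and the window `(s, t]` dissipates at most
`∫⁻_{(s,t]} D ≤ ofReal ((ν/L)(e^{t−s} − 1)Ω(s))`, since `D(τ) = (ν/L)∫∫|∇(u,v)|² = (ν/L)Ω(τ) ≤ (ν/L)e^{τ−s}Ω(s)`
(`layerDissipation_eq_ofReal`, `kato_integral_gradSq_eq_enstrophy`) integrates to `(ν/L)Ω(s)(e^{t−s} − 1)`.
[folklore] -/
theorem enstrophy_window_ceiling : ∀ (ν L : ℝ), 0 < ν → 0 < L → ∀ (u v p : ℝ → ℝ → ℝ → ℝ), IsStretchedLayerNSSolutionOn (Ioi 0) ν 1 1 L u v p → (∀ a b : ℝ, 0 < a → a < b → ExpTails (Icc a b) u v) → ∀ s t : ℝ, 0 < s → s ≤ t → (∫ x in Ioc 0 L, ∫ y, vorticity (u t) (v t) x y ^ 2) ≤ Real.exp (t - s) * (∫ x in Ioc 0 L, ∫ y, vorticity (u s) (v s) x y ^ 2) ∧ ∫⁻ τ in Ioc s t, layerDissipation ν L (u τ) (v τ) ≤ ENNReal.ofReal (ν / L * (Real.exp (t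 - s) - 1) * ∫ x in Ioc 0 L, ∫ y, vorticity (u s) (v s) x y ^ 2) := by
  intro ν L hν hL u v p hsol htails s t hs hst
  have hνL : 0 ≤ ν / L := div_nonneg hν.le hL.le
  -- slice facts at a time `τ > 0`: Fubini for `ω²`, and the dissipation as the real number `(ν/L)∫∫ω²`
  have hfacts : ∀ τ : ℝ, 0 < τ →
      (∫ x in Ioc 0 L, ∫ y, vorticity (u τ) (v τ) x y ^ 2) =
        ∫ q in Ioc 0 L ×ˢ univ, vorticity (u τ) (v τ) q.1 q.2 ^ 2 ∧
      layerDissipation ν L (u τ) (v τ) =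
        ENNReal.ofReal (ν / L * ∫ q in Ioc 0 L ×ˢ univ, vorticity (u τ) (v τ) q.1 q.2 ^ 2) := by
    intro τ hτ
    obtain ⟨C, k, hk, hCk⟩ := htails (τ / 2) (τ + 1) (by positivity) (by linarith)
    have hτI : τ ∈ Icc (τ / 2) (τ + 1) := ⟨by linarith, by linarith⟩
    have hT : SliceTails C k (u τ) (v τ) := (hCk τ hτI).1
    have hτ' : τ ∈ Ioi (0:ℝ) := hτ
    have hu2 := hsol.contDiff_u hτ'
    have hv2 := hsol.contDiff_v hτ'
    refine ⟨integral_iterated_eq_strip (enstrophyCeiling_integrableOn_sq hk hT hu2 hv2), ?_⟩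
    have hTd : ∀ x y, |deriv (fun r => u r x y) τ| + |deriv (fun r => v r x y) τ| ≤ C * Real.exp (-k * |y|) := by
      intro x y
      have h1 := (hCk τ hτI).2 x y
      rwa [dT_of_isOpen isOpen_Ioi u hτ', dT_of_isOpen isOpen_Ioi v hτ'] at h1
    have hsl := stub_strainWorkIdentity_slice ν L τ C k u v p hL hτ hk hsol hT hTd
    have h1 : ContDiff ℝ 1 (fun q : ℝ × ℝ => u τ q.1 q.2) := hu2.of_le one_le_two
    have h2 : ContDiff ℝ 1 (fun q : ℝ × ℝ => v τ q.1 q.2) := hv2.of_le one_le_two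
    rw [layerDissipation_eq_ofReal hνL (((((continuous_dX h1).pow 2).add ((continuous_dY h1).pow 2)).add
      ((continuous_dX h2).pow 2)).add ((continuous_dY h2).pow 2)) hsl.2.2.1,
      kato_integral_gradSq_eq_enstrophy hL hk hT hu2 hv2 (hsol.divFree τ hτ') (hsol.periodic_u τ hτ')
        (hsol.periodic_v τ hτ')]
  have ht : 0 < t := hs.trans_le hst
  set Ωs : ℝ := ∫ q in Ioc 0 L ×ˢ univ, vorticity (u s) (v s) q.1 q.2 ^ 2 with hΩs
  have hΩs0 : 0 ≤ Ωs := setIntegral_nonneg (measurableSet_Ioc.prod MeasurableSet.univ) fun q _ => sq_nonneg _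
  rw [(hfacts t ht).1, (hfacts s hs).1]
  refine ⟨enstrophyCeiling_strip_law hsol hν hL htails hs hst, ?_⟩
  -- pointwise on `(s, t]`: `D(τ) = (ν/L)Ω(τ) ≤ (ν/L)Ω(s)e^{τ−s}`
  have hpt : ∀ τ ∈ Ioc s t, layerDissipation ν L (u τ) (v τ) ≤ ENNReal.ofReal (ν / L * Ωs * Real.exp (τ - s)) := by
    intro τ hτ
    rw [(hfacts τ (hs.trans hτ.1)).2]
    refine ENNReal.ofReal_le_ofReal ?_
    calc ν / L * ∫ q in Ioc 0 L ×ˢ univ, vorticity (u τ) (v τ) q.1 q.2 ^ 2 ≤ ν / L * (Real.exp (τ - s) * Ωs) :=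
          mul_le_mul_of_nonneg_left (enstrophyCeiling_strip_law hsol hν hL htails hs hτ.1.le) hνL
      _ = ν / L * Ωs * Real.exp (τ - s) := by ring
  -- integrate over `(s, t]` in `ℝ≥0∞`
  have hI : IntegrableOn (fun τ => ν / L * Ωs * Real.exp (τ - s)) (Ioc s t) :=
    ((continuous_const.mul (Real.continuous_exp.comp (continuous_id.sub continuous_const))).integrableOn_Icc).mono_set
      Ioc_subset_Icc_self
  have hval : ∫ τ in Ioc s t, ν / L * Ωs * Real.exp (τ - s) = ν / L * (Real.exp (t - s) - 1) * Ωs := by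
    rw [integral_const_mul, ← intervalIntegral.integral_of_le hst]
    simp only [intervalIntegral.integral_comp_sub_right, integral_exp, sub_self, Real.exp_zero]
    ring
  calc ∫⁻ τ in Ioc s t, layerDissipation ν L (u τ) (v τ)
      ≤ ∫⁻ τ in Ioc s t, ENNReal.ofReal (ν / L * Ωs * Real.exp (τ - s)) := setLIntegral_mono' measurableSet_Ioc hpt
    _ = ENNReal.ofReal (∫ τ in Ioc s t, ν / L * Ωs * Real.exp (τ - s)) :=
        (ofReal_integral_eq_lintegral_ofReal hI (Eventually.of_forall fun τ => by
          simp only [Pi.zero_apply]; exact mul_nonneg (mul_nonneg hνL hΩs0) (Real.exp_pos _).le)).symm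
    _ = ENNReal.ofReal (ν / L * (Real.exp (t - s) - 1) * Ωs) := by rw [hval]

end Main

end Summit.AnomalousDissipation.AnomalousDissipation.Theorems.StrainedLayerLaw.LogEnstrophyClock

end
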